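import Literature.MathematicalPhysics.KineticTheory.HardSphereEulerProofs
import HarnessLib

/-!
# `BlockEntropyBudget` — the tilt identity `dLG/dG`

Helper file for the support item stmt-AtomisticToContinuum-14427 (`BlockEntropyBudget`, route
`SuperextensiveClosureCost`, sub-problem `HydrodynamicLimit`): the first analytic input of the
printed mechanism, "`dLG/dG = exp(N·Λ_N(U_N(0)))` with `Λ_N` LINEAR in the time-`0` empirical
fields".

* `localGibbsLaw_eq_withDensity_localGibbsLaw_const`: for continuous profiles `a₀, θ₀ > 0`, `u₀`,
  a reference temperature `θe > 0` and `σ ≤ 1/2`, the local Gibbs law is the homogeneous canonical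
  Gibbs law `G_N = localGibbsLaw σ 1 0 θe N Φ` with the explicit density
  `(Z_G/Z_LG) · ∏ᵢ f(zᵢ)/f_e(zᵢ)`, `f = localGibbsProfile a₀ u₀ θ₀`, `f_e = localGibbsProfile 1 0 θe`.
* `localGibbsProfile_div_const_eq_exp`: the one-particle ratio is
  `f(x,v)/f_e(x,v) = exp (log a₀ x − (3/2) log (θ₀ x/θe) − ‖v − u₀ x‖²/(2 θ₀ x) + ‖v‖²/(2θe))`,
  a quadratic polynomial in `v` with `x`-dependent coefficients.
* `prod_localGibbsProfile_div_const_eq_exp_sum`: hence the density is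
  `(Z_G/Z_LG) · exp (∑ᵢ g(xᵢ, vᵢ))`.
* `sum_eq_card_mul_integral_empiricalMeasure`: `∑ᵢ φ(zᵢ) = (N+1) ∫ φ dμ_z` — the exponent is
  `(N+1)` times a LINEAR functional of the empirical measure (hence of the empirical density /
  momentum / energy fields, `g` being quadratic in `v`).

References: C. Kipnis, C. Landim, *Scaling Limits of Interacting Particle Systems* (1999), Ch. 6
§1 (relative density of a local equilibrium w.r.t. the invariant state is the exponential of a
linear statistic); H. Spohn, *Large Scale Dynamics of Interacting Particles* (1991), Part I §2.3.
-/

noncomputable section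

namespace Summit.AtomisticToContinuum.HydrodynamicLimit.Theorems

open MeasureTheory
open Literature.Analysis.FluidPDE Literature.MathematicalPhysics.KineticTheory
open scoped ENNReal

variable {a₀ θ₀ : T3 → ℝ} {u₀ : T3 → V3} {σ θe : ℝ}

/-- The finite-dimensional rank of velocity space is `3`. [folklore] -/
theorem finrank_V3_eq_three : Module.finrank ℝ V3 = 3 := by
  simp

/-- **One-particle tilt.** For `a₀ x > 0`, `θ₀ x > 0`, `θe > 0`:
`f(x,v)/f_e(x,v) = exp (log a₀ x − (3/2) log (θ₀ x/θe) − ‖v − u₀ x‖²/(2θ₀ x) + ‖v‖²/(2θe))` where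
`f = localGibbsProfile a₀ u₀ θ₀` and `f_e = localGibbsProfile 1 0 θe` — a quadratic polynomial in
`v`, i.e. LINEAR in `(1, v, ‖v‖²)`. [cite: KipnisLandim1999, Ch. 6 §1] -/
theorem localGibbsProfile_div_const_eq_exp (ha0 : ∀ x, 0 < a₀ x) (hθ0 : ∀ x, 0 < θ₀ x)
    (hθe : 0 < θe) (y : T3 × V3) :
    localGibbsProfile a₀ u₀ θ₀ y / localGibbsProfile (fun _ => 1) (fun _ => 0) (fun _ => θe) y =
      Real.exp (Real.log (a₀ y.1) - 3 / 2 * Real.log (θ₀ y.1 / θe)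
        - ‖y.2 - u₀ y.1‖ ^ 2 / (2 * θ₀ y.1) + ‖y.2‖ ^ 2 / (2 * θe)) := by
  have hθ := hθ0 y.1
  have ha := ha0 y.1
  have h2π : (0 : ℝ) < 2 * Real.pi := by positivity
  simp only [localGibbsProfile, localMaxwellian, finrank_V3_eq_three, one_mul, sub_zero]
  -- normalise the Gaussian prefactors as exponentials
  have hpow : ∀ {θ : ℝ}, 0 < θ →
      (2 * Real.pi * θ) ^ (-((3 : ℕ) : ℝ) / 2) = Real.exp (-(3 / 2) * Real.log (2 * Real.pi * θ)) := by
    intro θ hθ'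
    rw [Real.rpow_def_of_pos (by positivity)]
    congr 1
    push_cast
    ring
  rw [hpow hθ, hpow hθe, ← Real.exp_log ha]
  rw [← Real.exp_add, ← Real.exp_add, ← Real.exp_add, ← Real.exp_sub]
  congr 1
  rw [Real.log_exp, Real.log_div hθ.ne' hθe.ne', Real.log_mul (by positivity) hθ.ne',
    Real.log_mul (by positivity) hθe.ne']
  ring

/-- **`N`-particle tilt as the exponential of a linear statistic.**
`∏ᵢ f(zᵢ)/f_e(zᵢ) = exp (∑ᵢ g(zᵢ))` with the one-particle exponent `g` of
`localGibbsProfile_div_const_eq_exp`. [cite: KipnisLandim1999, Ch. 6 §1] -/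
theorem prod_localGibbsProfile_div_const_eq_exp_sum (ha0 : ∀ x, 0 < a₀ x) (hθ0 : ∀ x, 0 < θ₀ x)
    (hθe : 0 < θe) {n : ℕ} (z : Config n (Fin 3) T3) :
    ∏ i, localGibbsProfile a₀ u₀ θ₀ (z i) / localGibbsProfile (fun _ => 1) (fun _ => 0) (fun _ => θe) (z i) =
      Real.exp (∑ i, (Real.log (a₀ (z i).1) - 3 / 2 * Real.log (θ₀ (z i).1 / θe)
        - ‖(z i).2 - u₀ (z i).1‖ ^ 2 / (2 * θ₀ (z i).1) + ‖(z i).2‖ ^ 2 / (2 * θe))) := by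
  rw [Real.exp_sum]
  exact Finset.prod_congr rfl fun i _ => localGibbsProfile_div_const_eq_exp ha0 hθ0 hθe (z i)

/-- **Linear statistics are `(N+1)`× the empirical average.** `∑ᵢ φ(zᵢ) = n · ∫ φ dμ_z` for the
empirical measure `μ_z = n⁻¹ ∑ᵢ δ_{zᵢ}` (`n ≥ 1`). [folklore] -/
theorem sum_eq_card_mul_integral_empiricalMeasure {n : ℕ} (hn : n ≠ 0) (z : Config n (Fin 3) T3)
    (φ : T3 × V3 → ℝ) :
    ∑ i, φ (z i) = (n : ℝ) * ∫ y, φ y ∂empiricalMeasure z := by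
  rw [integral_empiricalMeasure, ← mul_assoc, mul_inv_cancel₀ (by exact_mod_cast hn), one_mul]

/-- The reference (homogeneous) profile `f_e = localGibbsProfile 1 0 θe` is positive. [folklore] -/
theorem localGibbsProfile_const_pos (hθe : 0 < θe) (y : T3 × V3) :
    0 < localGibbsProfile (fun _ => 1) (fun _ => 0) (fun _ => θe) y := by
  simp only [localGibbsProfile, one_mul]
  exact localMaxwellian_pos one_pos hθe _ _

/-- **Tilt identity `dLG/dG`.** For continuous profiles `a₀, θ₀ > 0`, `u₀`, a reference temperature
`θe > 0` and `σ ≤ 1/2` (so that both partition functions are positive), the local Gibbs law is the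
homogeneous canonical Gibbs law `G_N = localGibbsLaw σ 1 0 θe N Φ` tilted by the explicit density
`z ↦ (Z_G/Z_LG) · ∏ᵢ f(zᵢ)/f_e(zᵢ)` (`= (Z_G/Z_LG) exp (∑ᵢ g(zᵢ))` by
`prod_localGibbsProfile_div_const_eq_exp_sum`). [cite: KipnisLandim1999, Ch. 6 §1] -/
theorem localGibbsLaw_eq_withDensity_localGibbsLaw_const (ha : Continuous a₀) (hθ : Continuous θ₀)
    (hu : Continuous u₀) (ha0 : ∀ x, 0 < a₀ x) (hθ0 : ∀ x, 0 < θ₀ x) (hθe : 0 < θe)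
    (hσ2 : σ ≤ 1 / 2) (N : ℕ)
    (Φ : HardSphereFlow (Torus.geometry (Fin 3)) (hsDiameter σ N) (N + 1)) :
    localGibbsLaw σ a₀ u₀ θ₀ N Φ =
      (localGibbsLaw σ (fun _ => 1) (fun _ => 0) (fun _ => θe) N Φ).withDensity fun z =>
        ENNReal.ofReal
          (canonicalPartition (Torus.geometry (Fin 3)) (hsDiameter σ N) (N + 1)
              (localGibbsProfile (fun _ => 1) (fun _ => 0) (fun _ => θe)) /
            canonicalPartition (Torus.geometry (Fin 3)) (hsDiameter σ N) (N + 1)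
              (localGibbsProfile a₀ u₀ θ₀) *
          ∏ i, localGibbsProfile a₀ u₀ θ₀ (z i) /
            localGibbsProfile (fun _ => 1) (fun _ => 0) (fun _ => θe) (z i)) := by
  -- notation
  set G3 := Torus.geometry (Fin 3) with hG3
  set ε := hsDiameter σ N with hε
  set f := localGibbsProfile a₀ u₀ θ₀ with hf
  set fe := localGibbsProfile (fun _ : T3 => (1 : ℝ)) (fun _ : T3 => (0 : V3)) (fun _ : T3 => θe)
    with hfe
  set Z := canonicalPartition G3 ε (N + 1) f with hZ
  set Ze := canonicalPartition G3 ε (N + 1) fe with hZe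
  -- positivity of the partition functions (σ ≤ 1/2) and of the reference profile
  have hZpos : 0 < Z := by
    rw [hZ, hf, hG3, canonicalPartition_eq_posPartition ha hθ hu (fun x => (ha0 x).le) hθ0]
    exact posPartition_pos ha ha0 hσ2 N
  have hZepos : 0 < Ze := by
    rw [hZe, hfe, hG3, canonicalPartition_eq_posPartition continuous_const continuous_const
      continuous_const (fun _ => zero_le_one) (fun _ => hθe)]
    exact posPartition_pos continuous_const (fun _ => one_pos) hσ2 N
  have hfe_pos : ∀ y, 0 < fe y := fun y => localGibbsProfile_const_pos hθe y
  have hf_nn : ∀ y, 0 ≤ f y := fun y =>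
    localGibbsProfile_nonneg (fun x => (ha0 x).le) (fun x => (hθ0 x).le) y
  -- measurability
  have hfm : Measurable f := measurable_localGibbsProfile ha hθ hu
  have hfem : Measurable fe :=
    measurable_localGibbsProfile continuous_const continuous_const continuous_const
  have hcd_e : Measurable fun z : Config (N + 1) (Fin 3) T3 =>
      ENNReal.ofReal (canonicalDensity G3 ε (N + 1) fe z) :=
    (measurable_canonicalDensity ε (N + 1) hfem).ennreal_ofReal
  have hratio : Measurable fun z : Config (N + 1) (Fin 3) T3 =>
      ENNReal.ofReal (Ze / Z * ∏ i, f (z i) / fe (z i)) := by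
    refine (measurable_const.mul (Finset.measurable_prod _ fun i _ => ?_)).ennreal_ofReal
    exact (hfm.comp (measurable_pi_apply i)).div (hfem.comp (measurable_pi_apply i))
  -- both sides as `volume.withDensity`
  rw [localGibbsLaw_eq, localGibbsLaw_eq]
  simp only [localGibbsMeasure]
  rw [← withDensity_mul _ hcd_e hratio]
  refine withDensity_congr_ae (Filter.Eventually.of_forall fun z => ?_)
  simp only [Pi.mul_apply]
  by_cases hzD : z ∈ hardSphereDomain G3 (N + 1) ε
  · -- on the hard-sphere domain: algebra
    have hcd : canonicalDensity G3 ε (N + 1) f z = Z⁻¹ * ∏ i, f (z i) := by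
      simp [canonicalDensity, Set.indicator_of_mem hzD, tensorPow, hZ]
    have hcde : canonicalDensity G3 ε (N + 1) fe z = Ze⁻¹ * ∏ i, fe (z i) := by
      simp [canonicalDensity, Set.indicator_of_mem hzD, tensorPow, hZe]
    have hPe_pos : 0 < ∏ i, fe (z i) := Finset.prod_pos fun i _ => hfe_pos (z i)
    have hcde_nn : 0 ≤ canonicalDensity G3 ε (N + 1) fe z := by
      rw [hcde]; positivity
    rw [hcd, hcde, ← ENNReal.ofReal_mul (by rw [← hcde]; exact hcde_nn)]
    congr 1
    have hprod : (∏ i, fe (z i)) * ∏ i, f (z i) / fe (z i) = ∏ i, f (z i) := by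
      rw [← Finset.prod_mul_distrib]
      exact Finset.prod_congr rfl fun i _ => mul_div_cancel₀ _ (hfe_pos (z i)).ne'
    calc Z⁻¹ * ∏ i, f (z i) = Z⁻¹ * ((∏ i, fe (z i)) * ∏ i, f (z i) / fe (z i)) := by rw [hprod]
      _ = Ze⁻¹ * (∏ i, fe (z i)) * (Ze / Z * ∏ i, f (z i) / fe (z i)) := by
          field_simp
  · -- off the domain both canonical densities vanish
    rw [canonicalDensity_eq_zero_of_notMem G3 ε (N + 1) f hzD,
      canonicalDensity_eq_zero_of_notMem G3 ε (N + 1) fe hzD]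
    simp

end Summit.AtomisticToContinuum.HydrodynamicLimit.Theorems

end
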